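import Summits.QuantumFields.YangMills.Theorems.IR.TelescopedCodingNoiseSplit
import Summits.QuantumFields.YangMills.Theorems.IR.TelescopedCodingBlocks
import HarnessLib

/-!
# Crux `IR` (stmt-QuantumFields-19354), line `telescoped-coding`: stub C2 PROVED — `composeCoders_holds`

Helper module for item `stmt-QuantumFields-19354` (`--supports … --as helper`).  The registered stub `TelescopedCoding.stub_composeCoders` of
skeleton v2 `Cruxes/IR/Lines/telescoped_coding.lean` (statement over the tree constants of `Theorems/IR/TelescopedCodingDefs.lean`, p596243)
closes by `exact composeCoders_holds`: **a coarse coder at block side `M` (block radius `b₁`, tails `K₁e^{-k}`) and a conditional coder below `M`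
(block radius `b₂`, tails `K₂e^{-k}`) compose to a Haar coder at radius `c·M`**, with `c = 2(b₁+b₂)+1` and
`K = max K₂ 0 + 1536·(4b₂+3)⁴·max K₁ 0` depending on `K₁, K₂, b₁, b₂` ONLY (group-, `β`-, `M`- and volume-blind).

**Proof.**  `Φ ω := Ψ (reblock (Φ₁ ω_even), ω_odd)`: the even half of the sequence noise feeds the coarse coder `Φ₁`, whose output is
re-blockified (`reblock` fixes block fields, so the LAW is unchanged and the output is SURELY block-constant), the odd half and that block field
feed the exact conditional sampler `Ψ`.  Law: part 1 (`law_compose_of_coders`, independence of the halves).  Locality at `(e, k)`: run both stages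
at parameter `2k`; off the conditional stage's exceptional event (pulled back along the measure-preserving `ω ↦ (reblock (Φ₁ ω_even), ω_odd)`) the
output at `e` is `Ψ'(V, ω_odd)` read on the input ball `B₂` of radius `2kMb₂`; `V = reblock (Φ₁ ω_even)` on `B₂` is determined by the values of
`Φ₁ ω_even` at the CORNER EDGES of the blocks meeting `B₂`; each corner edge is the reduction of a corner lift within `2kMb₂ + M` of `e` (part 2,
`exists_cornerLift`) and is coded by the coarse stage off mass `K₁e^{-2k}` from the noise within `2kMb₁` of that lift — all inside radius
`k·cM` of `e`.  The number of corner edges is `≤ 64(4kb₂+3)⁴` UNIFORMLY IN `M` (injection `cornerLift_coord_eq` of part 2: a corner lift is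
determined by its `M`-quantised window position, its "multiple of `N`" bits and its direction), so the total exceptional mass is
`(K₂ + 64(4kb₂+3)⁴K₁)e^{-2k} ≤ K e^{-k}` (`k⁴ ≤ 24 e^{k}`).

HONEST FRAMING: C2 is the provable COMPOSITION stub of ONE conditional line of the OPEN gap-crux `IR`; the line's loads (T: cluster-region coder,
U: conditional small-field coder) are research-level and untouched; nothing here proves weak-coupling decorrelation or the YM mass gap (Clay, NOT
proved); `R4` closes only the conditional rung `BalabanLadder.UV`.
-/

set_option autoImplicit false

noncomputable section

open MeasureTheory Filter Function
open Literature.MathematicalPhysics.QuantumFieldTheory Literature.MathematicalPhysics.QuantumLattice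

namespace Summit.QuantumFields.YangMills.Cruxes.IR.TelescopedCoding

/-! ## §1 Arithmetic of the tails -/

section Arith

/-- `k⁴ ≤ 24·e^k`. -/
theorem pow_four_le_exp (k : ℕ) : ((k : ℝ)) ^ 4 ≤ 24 * Real.exp (k : ℝ) := by
  have h := Real.pow_div_factorial_le_exp (k : ℝ) (by positivity) 4
  have h24 : ((Nat.factorial 4 : ℕ) : ℝ) = 24 := by norm_num [Nat.factorial]
  rw [h24, div_le_iff₀ (by norm_num)] at h
  linarith

/-- The tail bookkeeping of the composite coder: `K₂' e^{-2k} + Q·K₁' e^{-2k} ≤ K e^{-k}` for `Q ≤ 64(4kb₂+3)⁴`. -/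
theorem tail_arith {K₁ K₂ Q : ℝ} {b₂ k : ℕ} (hk : 1 ≤ k)
    (hQ : Q ≤ 64 * ((4 * k * b₂ + 3 : ℕ) : ℝ) ^ 4) :
    max K₂ 0 * Real.exp (-((2 * k : ℕ) : ℝ)) + Q * (max K₁ 0 * Real.exp (-((2 * k : ℕ) : ℝ))) ≤
      (max K₂ 0 + 1536 * ((4 * b₂ + 3 : ℕ) : ℝ) ^ 4 * max K₁ 0) * Real.exp (-(k : ℝ)) := by
  have hK₁ : 0 ≤ max K₁ 0 := le_max_right _ _
  have hK₂ : 0 ≤ max K₂ 0 := le_max_right _ _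
  have hE0 : 0 < Real.exp (-(k : ℝ)) := Real.exp_pos _
  have hE1 : Real.exp (-(k : ℝ)) ≤ 1 := Real.exp_le_one_iff.2 (by simp)
  have h2k : Real.exp (-((2 * k : ℕ) : ℝ)) = Real.exp (-(k : ℝ)) * Real.exp (-(k : ℝ)) := by
    rw [← Real.exp_add]; congr 1; push_cast; ring
  have hk1 : (1 : ℝ) ≤ k := by exact_mod_cast hk
  have hpoly : ((4 * k * b₂ + 3 : ℕ) : ℝ) ≤ (k : ℝ) * ((4 * b₂ + 3 : ℕ) : ℝ) := by
    push_cast; nlinarith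
  have hpoly4 : ((4 * k * b₂ + 3 : ℕ) : ℝ) ^ 4 ≤ (k : ℝ) ^ 4 * ((4 * b₂ + 3 : ℕ) : ℝ) ^ 4 := by
    rw [← mul_pow]; exact pow_le_pow_left₀ (by positivity) hpoly 4
  have hk4 := pow_four_le_exp k
  have hkey : ((4 * k * b₂ + 3 : ℕ) : ℝ) ^ 4 * Real.exp (-(k : ℝ)) ≤ 24 * ((4 * b₂ + 3 : ℕ) : ℝ) ^ 4 := by
    have h1 : Real.exp (k : ℝ) * Real.exp (-(k : ℝ)) = 1 := by rw [← Real.exp_add, add_neg_cancel, Real.exp_zero]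
    calc ((4 * k * b₂ + 3 : ℕ) : ℝ) ^ 4 * Real.exp (-(k : ℝ))
        ≤ (k : ℝ) ^ 4 * ((4 * b₂ + 3 : ℕ) : ℝ) ^ 4 * Real.exp (-(k : ℝ)) := mul_le_mul_of_nonneg_right hpoly4 hE0.le
      _ ≤ 24 * Real.exp (k : ℝ) * ((4 * b₂ + 3 : ℕ) : ℝ) ^ 4 * Real.exp (-(k : ℝ)) :=
          mul_le_mul_of_nonneg_right (mul_le_mul_of_nonneg_right hk4 (by positivity)) hE0.le
      _ = 24 * ((4 * b₂ + 3 : ℕ) : ℝ) ^ 4 := by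
          have : 24 * Real.exp (k : ℝ) * ((4 * b₂ + 3 : ℕ) : ℝ) ^ 4 * Real.exp (-(k : ℝ)) =
              24 * ((4 * b₂ + 3 : ℕ) : ℝ) ^ 4 * (Real.exp (k : ℝ) * Real.exp (-(k : ℝ))) := by ring
          rw [this, h1, mul_one]
  rw [h2k]
  have hT1 : max K₂ 0 * (Real.exp (-(k : ℝ)) * Real.exp (-(k : ℝ))) ≤ max K₂ 0 * Real.exp (-(k : ℝ)) := by
    refine mul_le_mul_of_nonneg_left ?_ hK₂
    calc Real.exp (-(k : ℝ)) * Real.exp (-(k : ℝ)) ≤ Real.exp (-(k : ℝ)) * 1 := mul_le_mul_of_nonneg_left hE1 hE0.le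
      _ = Real.exp (-(k : ℝ)) := mul_one _
  have hT2 : Q * (max K₁ 0 * (Real.exp (-(k : ℝ)) * Real.exp (-(k : ℝ)))) ≤
      1536 * ((4 * b₂ + 3 : ℕ) : ℝ) ^ 4 * max K₁ 0 * Real.exp (-(k : ℝ)) := by
    calc Q * (max K₁ 0 * (Real.exp (-(k : ℝ)) * Real.exp (-(k : ℝ))))
        ≤ 64 * ((4 * k * b₂ + 3 : ℕ) : ℝ) ^ 4 * (max K₁ 0 * (Real.exp (-(k : ℝ)) * Real.exp (-(k : ℝ)))) :=
          mul_le_mul_of_nonneg_right hQ (by positivity)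
      _ = 64 * (((4 * k * b₂ + 3 : ℕ) : ℝ) ^ 4 * Real.exp (-(k : ℝ))) * max K₁ 0 * Real.exp (-(k : ℝ)) := by ring
      _ ≤ 64 * (24 * ((4 * b₂ + 3 : ℕ) : ℝ) ^ 4) * max K₁ 0 * Real.exp (-(k : ℝ)) := by
          have := hkey
          gcongr
      _ = 1536 * ((4 * b₂ + 3 : ℕ) : ℝ) ^ 4 * max K₁ 0 * Real.exp (-(k : ℝ)) := by ring
  calc max K₂ 0 * (Real.exp (-(k : ℝ)) * Real.exp (-(k : ℝ))) + Q * (max K₁ 0 * (Real.exp (-(k : ℝ)) * Real.exp (-(k : ℝ))))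
      ≤ max K₂ 0 * Real.exp (-(k : ℝ)) + 1536 * ((4 * b₂ + 3 : ℕ) : ℝ) ^ 4 * max K₁ 0 * Real.exp (-(k : ℝ)) := add_le_add hT1 hT2
    _ = (max K₂ 0 + 1536 * ((4 * b₂ + 3 : ℕ) : ℝ) ^ 4 * max K₁ 0) * Real.exp (-(k : ℝ)) := by ring

end Arith

/-! ## §2 Counting the blocks that meet an input ball, uniformly in the block side -/

section Count

/-- **At most `64·(2R'+3)⁴` corner edges arise from an input ball of radius `M·R'`** (`0 < M ≤ N`), whatever `M` and the volume. -/
theorem card_corners_le {M N : ℕ} [NeZero N] (hM : 0 < M) (hMN : M ≤ N) (e : ZdEdge 4) (R' : ℕ)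
    (Q : Finset (Edge 4 N)) (hQ : ∀ q ∈ Q, ∃ x ∈ inputBall N e (M * R'), cornerEdge M N x = q) :
    Q.card ≤ 64 * (2 * R' + 3) ^ 4 := by
  classical
  have hlift : ∀ q ∈ Q, ∃ e₁ : ZdEdge 4, torusEdge N e₁ = q ∧ supDist e₁.1 e.1 ≤ M * R' + M ∧ IsCornerLift M N e₁ := by
    intro q hq
    obtain ⟨x, hx, rfl⟩ := hQ q hq
    exact exists_cornerLift hM hx
  choose! lift hlift₁ hlift₂ hlift₃ using hlift
  obtain ⟨A, hA⟩ : ∃ A : Fin 4 → ℤ, A = fun l => e.1 l - ((M * R' + M : ℕ) : ℤ) := ⟨_, rfl⟩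
  obtain ⟨ι, hι⟩ : ∃ ι : Edge 4 N → (Fin 4 → ℕ) × (Fin 4 → Bool) × Fin 4, ι = fun q =>
      (fun l => ((lift q).1 l - A l).toNat / M, fun l => decide ((lift q).1 l % (N : ℤ) = 0), q.2) := ⟨_, rfl⟩
  obtain ⟨Tgt, hTgt⟩ : ∃ Tgt : Finset ((Fin 4 → ℕ) × (Fin 4 → Bool) × Fin 4),
      Tgt = (Fintype.piFinset fun _ : Fin 4 => Finset.range (2 * R' + 3)) ×ˢ (Finset.univ ×ˢ Finset.univ) := ⟨_, rfl⟩
  -- window bounds for lifts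
  have hwin : ∀ q ∈ Q, ∀ l : Fin 4, A l ≤ (lift q).1 l ∧ ((lift q).1 l - A l).toNat / M < 2 * R' + 3 := by
    intro q hq l
    have h1 : ((lift q).1 l - e.1 l).natAbs ≤ M * R' + M := supDist_le_iff.1 (hlift₂ q hq) l
    have h2 : A l ≤ (lift q).1 l := by
      rw [hA]; simp only
      omega
    refine ⟨h2, ?_⟩
    have h3 : ((lift q).1 l - A l).toNat ≤ 2 * (M * R' + M) := by
      have h4 : (lift q).1 l - A l ≤ ((2 * (M * R' + M) : ℕ) : ℤ) := by
        rw [hA]; simp only; push_cast; omega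
      have h5 : (((lift q).1 l - A l).toNat : ℤ) = (lift q).1 l - A l := Int.toNat_of_nonneg (by linarith)
      omega
    have h6 : ((lift q).1 l - A l).toNat / M ≤ 2 * (M * R' + M) / M := Nat.div_le_div_right h3
    have h7 : 2 * (M * R' + M) / M = 2 * (R' + 1) := by
      rw [show 2 * (M * R' + M) = M * (2 * (R' + 1)) by ring, Nat.mul_div_cancel_left _ hM]
    omega
  have hmaps : Set.MapsTo ι (Q : Set (Edge 4 N)) (Tgt : Set ((Fin 4 → ℕ) × (Fin 4 → Bool) × Fin 4)) := by
    intro q hq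
    rw [Finset.mem_coe] at hq
    rw [Finset.mem_coe, hTgt, Finset.mem_product, Finset.mem_product, hι]
    refine ⟨?_, Finset.mem_univ _, Finset.mem_univ _⟩
    rw [Fintype.mem_piFinset]
    intro l
    rw [Finset.mem_range]
    exact (hwin q hq l).2
  have hinj : Set.InjOn ι (Q : Set (Edge 4 N)) := by
    intro q₁ hq₁ q₂ hq₂ h
    rw [Finset.mem_coe] at hq₁ hq₂
    rw [hι] at h
    simp only [Prod.mk.injEq] at h
    obtain ⟨hidx, hbit, hdir⟩ := h
    have hcoord : ∀ l, (lift q₁).1 l = (lift q₂).1 l := by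
      intro l
      obtain ⟨κ₁, hκ₁, hm₁⟩ := hlift₃ q₁ hq₁ l
      obtain ⟨κ₂, hκ₂, hm₂⟩ := hlift₃ q₂ hq₂ l
      have hi := congrFun hidx l
      have hb := congrFun hbit l
      simp only [decide_eq_decide] at hb
      exact cornerLift_coord_eq hM hMN (hwin q₁ hq₁ l).1 (hwin q₂ hq₂ l).1 hκ₁ hκ₂ hm₁ hm₂ hi hb
    have hl : lift q₁ = lift q₂ := by
      refine Prod.ext (funext hcoord) ?_
      have h1 := congrArg Prod.snd (hlift₁ q₁ hq₁)
      have h2 := congrArg Prod.snd (hlift₁ q₂ hq₂)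
      simp only [torusEdge_snd] at h1 h2
      rw [h1, h2, hdir]
    rw [← hlift₁ q₁ hq₁, ← hlift₁ q₂ hq₂, hl]
  calc Q.card ≤ Tgt.card := Finset.card_le_card_of_injOn ι hmaps hinj
    _ = 64 * (2 * R' + 3) ^ 4 := by
        rw [hTgt, Finset.card_product, Finset.card_product, Fintype.card_piFinset, Finset.prod_const, Finset.card_range]
        simp only [Fintype.card_pi, Fintype.card_bool, Finset.prod_const, Finset.card_univ, Fintype.card_fin]
        norm_num [mul_comm]

end Count

/-! ## §3 Locality of the composite coder; the stub -/

section Compose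

variable {G : Type} [Group G] [TopologicalSpace G] [IsTopologicalGroup G] [CompactSpace G] [MeasurableSpace G] [BorelSpace G]

/-- The even half of a sequence noise is a sequence noise. -/
theorem seqNoise_map_evenPart (S : ℕ) : (seqNoise G S).map evenPart = seqNoise G S := by
  haveI : IsProbabilityMeasure (seqNoise G S) := isProbabilityMeasure_seqNoise _
  have h : (evenPart : Noise G S → Noise G S) = Prod.fst ∘ splitNoise := by funext ω; rfl
  rw [h, ← Measure.map_map measurable_fst measurable_splitNoise, seqNoise_map_splitNoise, Measure.map_fst_prod,
    measure_univ, one_smul]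

omit [Group G] [TopologicalSpace G] [IsTopologicalGroup G] [CompactSpace G] [MeasurableSpace G] [BorelSpace G] in
/-- Radius bookkeeping: a coarse ball around a corner lift sits inside the composite ball. -/
theorem radius_arith {d M k b₁ b₂ : ℕ} (hk : 1 ≤ k) (h : d ≤ M * (2 * k * b₂) + M) :
    d + 2 * k * (M * b₁) ≤ k * ((2 * (b₁ + b₂) + 1) * M) := by
  have h1 : M ≤ k * M := Nat.le_mul_of_pos_left M hk
  nlinarith

omit [Group G] [TopologicalSpace G] [IsTopologicalGroup G] [CompactSpace G] [MeasurableSpace G] [BorelSpace G] in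
/-- Radius bookkeeping: the conditional ball sits inside the composite ball. -/
theorem radius_arith' {M k b₁ b₂ : ℕ} : 2 * k * (M * b₂) ≤ k * ((2 * (b₁ + b₂) + 1) * M) := by
  have h : 2 * k * (M * b₂) + (2 * k * (M * b₁) + k * M) = k * ((2 * (b₁ + b₂) + 1) * M) := by ring
  rw [← h]
  exact Nat.le_add_right _ _

variable {N : ℕ} (ρ : G →* Matrix (Fin N) (Fin N) ℂ) (β : ℝ)

/-- **Locality of the composite coder at one link** (both stages run at parameter `2k`; union bound over the corner edges of the conditional
input ball, counted uniformly in `M`). -/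
theorem composite_locality {S M b₁ b₂ : ℕ} (hM : 0 < M) (hMN : M ≤ 2 * S + 1) {K₁ K₂ : ℝ}
    {Φ₁ : Noise G (2 * S + 1) → GaugeConfig 4 (2 * S + 1) G} (hΦ₁ : Measurable Φ₁)
    (hlaw₁ : (seqNoise G (2 * S + 1)).map Φ₁ =
      (wilsonMeasure (d := 4) (L := 2 * S + 1) ρ β).map (blockField M (2 * S + 1)))
    (hloc₁ : ∀ (e : ZdEdge 4) (k : ℕ), 1 ≤ k → ∃ Ψ₁ : Noise G (2 * S + 1) → G, Measurable Ψ₁ ∧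
        DependsOn Ψ₁ {p | p.2 ∈ inputBall (2 * S + 1) e (k * (M * b₁))} ∧
        seqNoise G (2 * S + 1) {ω | Φ₁ ω (torusEdge (2 * S + 1) e) ≠ Ψ₁ ω} ≤ ENNReal.ofReal (K₁ * Real.exp (-(k : ℝ))))
    {Ψ : GaugeConfig 4 (2 * S + 1) G × Noise G (2 * S + 1) → GaugeConfig 4 (2 * S + 1) G}
    (hloc₂ : ∀ (e : ZdEdge 4) (k : ℕ), 1 ≤ k →
      ∃ Ψ' : GaugeConfig 4 (2 * S + 1) G × Noise G (2 * S + 1) → G, Measurable Ψ' ∧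
        (∀ p q : GaugeConfig 4 (2 * S + 1) G × Noise G (2 * S + 1),
            (∀ x ∈ inputBall (2 * S + 1) e (k * (M * b₂)), p.1 x = q.1 x) →
            (∀ y : ℕ × Edge 4 (2 * S + 1), y.2 ∈ inputBall (2 * S + 1) e (k * (M * b₂)) → p.2 y = q.2 y) →
              Ψ' p = Ψ' q) ∧
        (((wilsonMeasure (d := 4) (L := 2 * S + 1) ρ β).map (blockField M (2 * S + 1))).prod (seqNoise G (2 * S + 1)))
            {p | Ψ p (torusEdge (2 * S + 1) e) ≠ Ψ' p} ≤ ENNReal.ofReal (K₂ * Real.exp (-(k : ℝ))))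
    (e : ZdEdge 4) (k : ℕ) (hk : 1 ≤ k) :
    ∃ Ψf : Noise G (2 * S + 1) → G, Measurable Ψf ∧
      DependsOn Ψf {p | p.2 ∈ inputBall (2 * S + 1) e (k * ((2 * (b₁ + b₂) + 1) * M))} ∧
      seqNoise G (2 * S + 1)
          {ω | Ψ (reblock M (2 * S + 1) (Φ₁ (evenPart ω)), oddPart ω) (torusEdge (2 * S + 1) e) ≠ Ψf ω} ≤
        ENNReal.ofReal ((max K₂ 0 + 1536 * ((4 * b₂ + 3 : ℕ) : ℝ) ^ 4 * max K₁ 0) * Real.exp (-(k : ℝ))) := by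
  classical
  haveI : IsProbabilityMeasure (seqNoise G (2 * S + 1)) := isProbabilityMeasure_seqNoise _
  haveI : NeZero (2 * S + 1) := ⟨by omega⟩
  have h2k : 1 ≤ 2 * k := by omega
  -- the conditional stage at parameter `2k`
  obtain ⟨Ψ', hΨ'm, hΨ'loc, hΨ'bad⟩ := hloc₂ e (2 * k) h2k
  -- coarse codes at parameter `2k` for every `ℤ⁴`-link
  choose Ψ₁ hΨ₁m hΨ₁dep hΨ₁bad using fun e' : ZdEdge 4 => hloc₁ e' (2 * k) h2k
  -- the corner edges of the conditional input ball and their lifts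
  obtain ⟨B₂, hB₂⟩ : ∃ B₂ : Set (Edge 4 (2 * S + 1)), B₂ = inputBall (2 * S + 1) e (2 * k * (M * b₂)) := ⟨_, rfl⟩
  obtain ⟨Q, hQ⟩ : ∃ Q : Finset (Edge 4 (2 * S + 1)),
      Q = Finset.univ.filter fun q => ∃ x ∈ B₂, cornerEdge M (2 * S + 1) x = q := ⟨_, rfl⟩
  have hQmem : ∀ q ∈ Q, ∃ x ∈ inputBall (2 * S + 1) e (M * (2 * k * b₂)), cornerEdge M (2 * S + 1) x = q := by
    intro q hq
    rw [hQ, Finset.mem_filter] at hq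
    obtain ⟨x, hx, hxq⟩ := hq.2
    refine ⟨x, ?_, hxq⟩
    rw [hB₂] at hx
    rwa [show M * (2 * k * b₂) = 2 * k * (M * b₂) by ring]
  have hlift : ∀ q ∈ Q, ∃ e₁ : ZdEdge 4, torusEdge (2 * S + 1) e₁ = q ∧ supDist e₁.1 e.1 ≤ M * (2 * k * b₂) + M ∧
      IsCornerLift M (2 * S + 1) e₁ := by
    intro q hq
    obtain ⟨x, hx, rfl⟩ := hQmem q hq
    exact exists_cornerLift hM hx
  choose! lift hlift₁ hlift₂ _hlift₃ using hlift
  have hcornerQ : ∀ x ∈ B₂, cornerEdge M (2 * S + 1) x ∈ Q := fun x hx => by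
    rw [hQ, Finset.mem_filter]; exact ⟨Finset.mem_univ _, x, hx, rfl⟩
  have hcard : (Q.card : ℝ) ≤ 64 * ((4 * k * b₂ + 3 : ℕ) : ℝ) ^ 4 := by
    have h1 := card_corners_le hM hMN e (2 * k * b₂) Q hQmem
    have h2 : 2 * (2 * k * b₂) + 3 = 4 * k * b₂ + 3 := by ring
    rw [h2] at h1
    exact_mod_cast h1
  -- the local surrogate
  obtain ⟨V, hV⟩ : ∃ V : Noise G (2 * S + 1) → GaugeConfig 4 (2 * S + 1) G,
      V = fun ω x => Ψ₁ (lift (cornerEdge M (2 * S + 1) x)) (evenPart ω) := ⟨_, rfl⟩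
  have hVm : Measurable V := by
    rw [hV]; exact measurable_pi_lambda _ fun x => (hΨ₁m _).comp measurable_evenPart
  refine ⟨fun ω => Ψ' (V ω, oddPart ω), hΨ'm.comp (hVm.prodMk measurable_oddPart), ?_, ?_⟩
  · -- dependence on the composite ball
    intro ω ω' hagree
    refine hΨ'loc (V ω, oddPart ω) (V ω', oddPart ω') (fun x hx => ?_) (fun y hy => ?_)
    · have hxB : x ∈ B₂ := by rw [hB₂]; exact hx
      have hd := hlift₂ _ (hcornerQ x hxB)
      rw [hV]
      refine hΨ₁dep (lift (cornerEdge M (2 * S + 1) x)) (fun p hp => ?_)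
      refine hagree _ ?_
      simp only [Set.mem_setOf_eq, parityIndex_snd] at hp ⊢
      exact inputBall_subset (radius_arith hk hd) hp
    · refine hagree _ ?_
      simp only [Set.mem_setOf_eq, parityIndex_snd] at hy ⊢
      exact inputBall_mono e radius_arith' hy
  · -- exceptional mass
    -- the pair fed to the conditional stage and its law
    have hT : Measurable fun ω : Noise G (2 * S + 1) => (reblock M (2 * S + 1) (Φ₁ (evenPart ω)), oddPart ω) :=
      ((measurable_reblock M (2 * S + 1)).comp (hΦ₁.comp measurable_evenPart)).prodMk measurable_oddPart
    have hlawT := law_pair_of_coders ρ β hΦ₁ hlaw₁ (measurable_reblock M (2 * S + 1)) (reblock_blockField hM)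
    -- pulled-back exceptional events
    have hbadC : seqNoise G (2 * S + 1) {ω | Ψ (reblock M (2 * S + 1) (Φ₁ (evenPart ω)), oddPart ω) (torusEdge (2 * S + 1) e) ≠
        Ψ' (reblock M (2 * S + 1) (Φ₁ (evenPart ω)), oddPart ω)} ≤ ENNReal.ofReal (max K₂ 0 * Real.exp (-((2 * k : ℕ) : ℝ))) := by
      refine le_trans (Measure.le_map_apply hT.aemeasurable {p | Ψ p (torusEdge (2 * S + 1) e) ≠ Ψ' p}) ?_
      rw [hlawT]
      refine hΨ'bad.trans (ENNReal.ofReal_le_ofReal ?_)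
      exact mul_le_mul_of_nonneg_right (le_max_left _ _) (Real.exp_pos _).le
    have hbadq : ∀ q ∈ Q, seqNoise G (2 * S + 1) {ω | Φ₁ (evenPart ω) (torusEdge (2 * S + 1) (lift q)) ≠ Ψ₁ (lift q) (evenPart ω)} ≤
        ENNReal.ofReal (max K₁ 0 * Real.exp (-((2 * k : ℕ) : ℝ))) := by
      intro q _
      refine le_trans (Measure.le_map_apply measurable_evenPart.aemeasurable
        {ω' | Φ₁ ω' (torusEdge (2 * S + 1) (lift q)) ≠ Ψ₁ (lift q) ω'}) ?_
      rw [seqNoise_map_evenPart]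
      refine (hΨ₁bad (lift q)).trans (ENNReal.ofReal_le_ofReal ?_)
      exact mul_le_mul_of_nonneg_right (le_max_left _ _) (Real.exp_pos _).le
    -- off the exceptional events the composite output is the surrogate
    have hsub : {ω | Ψ (reblock M (2 * S + 1) (Φ₁ (evenPart ω)), oddPart ω) (torusEdge (2 * S + 1) e) ≠ Ψ' (V ω, oddPart ω)} ⊆
        {ω | Ψ (reblock M (2 * S + 1) (Φ₁ (evenPart ω)), oddPart ω) (torusEdge (2 * S + 1) e) ≠
          Ψ' (reblock M (2 * S + 1) (Φ₁ (evenPart ω)), oddPart ω)} ∪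
        ⋃ q ∈ Q, {ω | Φ₁ (evenPart ω) (torusEdge (2 * S + 1) (lift q)) ≠ Ψ₁ (lift q) (evenPart ω)} := by
      intro ω hω
      by_contra hnot
      simp only [Set.mem_union, Set.mem_iUnion, Set.mem_setOf_eq, not_or, not_exists, not_not] at hnot
      obtain ⟨h1, h2⟩ := hnot
      apply hω
      rw [h1]
      refine hΨ'loc _ _ (fun x hx => ?_) (fun y _ => rfl)
      have hxB : x ∈ B₂ := by rw [hB₂]; exact hx
      have hq := hcornerQ x hxB
      show Φ₁ (evenPart ω) (cornerEdge M (2 * S + 1) x) = V ω x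
      rw [hV]
      simp only
      rw [← h2 _ hq, hlift₁ _ hq]
    -- the union bound
    have hK₁ : 0 ≤ max K₁ 0 * Real.exp (-((2 * k : ℕ) : ℝ)) := mul_nonneg (le_max_right _ _) (Real.exp_pos _).le
    have hK₂ : 0 ≤ max K₂ 0 * Real.exp (-((2 * k : ℕ) : ℝ)) := mul_nonneg (le_max_right _ _) (Real.exp_pos _).le
    calc seqNoise G (2 * S + 1)
          {ω | Ψ (reblock M (2 * S + 1) (Φ₁ (evenPart ω)), oddPart ω) (torusEdge (2 * S + 1) e) ≠ Ψ' (V ω, oddPart ω)}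
        ≤ seqNoise G (2 * S + 1) {ω | Ψ (reblock M (2 * S + 1) (Φ₁ (evenPart ω)), oddPart ω) (torusEdge (2 * S + 1) e) ≠
              Ψ' (reblock M (2 * S + 1) (Φ₁ (evenPart ω)), oddPart ω)} +
          seqNoise G (2 * S + 1) (⋃ q ∈ Q, {ω | Φ₁ (evenPart ω) (torusEdge (2 * S + 1) (lift q)) ≠ Ψ₁ (lift q) (evenPart ω)}) :=
          (measure_mono hsub).trans (measure_union_le _ _)
      _ ≤ ENNReal.ofReal (max K₂ 0 * Real.exp (-((2 * k : ℕ) : ℝ))) +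
          Q.card • ENNReal.ofReal (max K₁ 0 * Real.exp (-((2 * k : ℕ) : ℝ))) :=
          add_le_add hbadC ((measure_biUnion_finset_le _ _).trans (Finset.sum_le_card_nsmul _ _ _ hbadq))
      _ = ENNReal.ofReal (max K₂ 0 * Real.exp (-((2 * k : ℕ) : ℝ)) +
          (Q.card : ℝ) * (max K₁ 0 * Real.exp (-((2 * k : ℕ) : ℝ)))) := by
          rw [ENNReal.ofReal_add hK₂ (mul_nonneg (Nat.cast_nonneg _) hK₁), ENNReal.ofReal_mul (Nat.cast_nonneg _),
            ENNReal.ofReal_natCast, nsmul_eq_mul]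
      _ ≤ ENNReal.ofReal ((max K₂ 0 + 1536 * ((4 * b₂ + 3 : ℕ) : ℝ) ^ 4 * max K₁ 0) * Real.exp (-(k : ℝ))) :=
          ENNReal.ofReal_le_ofReal (tail_arith hk hcard)

/-- **Stub C2 PROVED — coders compose** (skeleton v2's `stub_composeCoders`, VERBATIM statement over the tree constants): a coarse coder at
block side `M` (block radius `b₁`) and a conditional coder below `M` (block radius `b₂`) compose to a Haar coder at radius `c·M`,
`c = 2(b₁+b₂)+1`, `K = max K₂ 0 + 1536·(4b₂+3)⁴·max K₁ 0`. -/
theorem composeCoders_holds :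
    ∀ (K₁ K₂ : ℝ) (b₁ b₂ : ℕ), ∃ (K : ℝ) (c : ℕ), 1 ≤ c ∧
      ∀ (G : Type) [Group G] [TopologicalSpace G] [IsTopologicalGroup G] [CompactSpace G]
        [MeasurableSpace G] [BorelSpace G] {N : ℕ} (ρ : G →* Matrix (Fin N) (Fin N) ℂ) (β : ℝ) (M : ℕ),
        1 ≤ M → CoarseCodedSeq ρ K₁ β M b₁ → CondCodedSeq ρ K₂ β M b₂ → HaarCodedSeq ρ K β (c * M) := by
  intro K₁ K₂ b₁ b₂
  refine ⟨max K₂ 0 + 1536 * ((4 * b₂ + 3 : ℕ) : ℝ) ^ 4 * max K₁ 0, 2 * (b₁ + b₂) + 1, by omega, ?_⟩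
  intro G _ _ _ _ _ _ N ρ β M hM hco hcd S hS
  have hS₁ : M * b₁ ≤ 2 * S + 1 := le_trans (by nlinarith) hS
  have hS₂ : M * b₂ ≤ 2 * S + 1 := le_trans (by nlinarith) hS
  have hMN : M ≤ 2 * S + 1 := le_trans (by nlinarith) hS
  obtain ⟨Φ₁, hΦ₁m, hlaw₁, hloc₁⟩ := hco S hS₁
  obtain ⟨Ψ, hΨm, hlaw₂, hloc₂⟩ := hcd S hS₂
  haveI : NeZero (2 * S + 1) := ⟨by omega⟩
  refine ⟨fun ω => Ψ (reblock M (2 * S + 1) (Φ₁ (evenPart ω)), oddPart ω),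
    hΨm.comp (((measurable_reblock M (2 * S + 1)).comp (hΦ₁m.comp measurable_evenPart)).prodMk measurable_oddPart),
    law_compose_of_coders ρ β hΦ₁m hlaw₁ hΨm hlaw₂ (measurable_reblock M (2 * S + 1)) (reblock_blockField hM), ?_⟩
  intro e k hk
  exact composite_locality ρ β hM hMN hΦ₁m hlaw₁ hloc₁ hloc₂ e k hk

end Compose

end Summit.QuantumFields.YangMills.Cruxes.IR.TelescopedCoding

end
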